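import Summits.CriticalPhenomena.PercolationContinuityZ3.Theorems.PercNearOneGluingNoHeavyQuantLawDEC
import Summits.CriticalPhenomena.PercolationContinuityZ3.Theorems.PercNearOneGluingNoHeavyQuantFarTreeTAMP
import HarnessLib

/-!
# QUANT lane R8, T-DEC — the first kernel rung of `Quant.TreeDEC` (every forest law is DEC(j′) at every layer `j′ ≥ #A`:
# Theorem A in gate coordinates) and MONOTONICITY OF DEC IN THE FLOOR (a lower floor is easier)

builds on p205010 (kernel theorem, internal audit signed; external expert review pending)

Support file (`--supports stmt-CriticalPhenomena-4575`), QUANT lane typer seat prim-quant-stmt (gen 18), rung R8 of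
`run/shared/lean/prim/quant/LADDER.md`.  Three theorems, no sorries, standard axioms.

* `Quant.LawDec.validAt_mono_floor` / `decAt_mono_floor` — for `x′ ≤ x < 1` validity at floor `x` implies validity at floor `x′`
  (heavy stays heavy; the credit rate `κ`-ite is pointwise non-increasing in the floor on `[0,1)`:
  `(g − x′²)/(1 − x′) − (g − x²)/(1 − x) = (x − x′)(x + x′ − x x′ − g)/((1 − x)(1 − x′)) ≥ 0` for `g < x′`), hence DEC(j′) too.
  So `Quant.TreeDEC`'s hypothesis "every marginal `≥ 1 − t`" is the same conjecture as "floor = least marginal" (DEC-TAMP-G50's `x`).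
* `Quant.treeDEC_of_card_le` — in `Quant.TreeDEC`'s binder shape (no forest axiom is needed for this rung): gates `q`, relays `A` with
  marginals `≥ 1 − t`, `0 < t ≤ 1` (floor in `[0, 1)`), layer `j′ ≥ #A` ⟹ the law of the reached-relay count is `LawDec.DECAt (1 − t) j′ #A`.
  (The structure labelling of `…QuantFarTreeTAMP` is specialised to one structure, `κ = Unit`.)

[this work]; Theorem A: prim-quant-census-2 g50 (this lane).  The gluing rows served [cite: KozmaNitzan2024, Conjecture 3 (p. 15)];
product measure [cite: Grimmett1999, §1.3 p. 10].
-/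

noncomputable section

namespace Summit.CriticalPhenomena.PercolationContinuityZ3.Theorems

namespace Quant

open Finset MeasureTheory
open Literature.Probability.LatticeModels
open Literature.Probability.Percolation
open scoped Classical

namespace LawDec

/-- **Validity is monotone in the floor**: `x′ ≤ x < 1`, `g ∈ [0,1]`, valid at `(x, T, j′)` ⟹ valid at `(x′, T, j′)`. [this work] -/
theorem validAt_mono_floor {x x' T g : ℝ} {j' lo hi : ℕ} (hxx : x' ≤ x) (hx1 : x < 1) (hg : 0 ≤ g ∧ g ≤ 1)
    (h : ValidAt x T j' lo hi g) : ValidAt x' T j' lo hi g := by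
  rcases h with hS | ⟨hlt, hgi, hxg⟩ | ⟨hlt, hhij, hcr⟩
  · exact Or.inl hS
  · exact Or.inr (Or.inl ⟨hlt, hgi, hxx.trans hxg⟩)
  · refine Or.inr (Or.inr ⟨hlt, hhij, hcr.trans ?_⟩)
    have hd : (0 : ℝ) ≤ (hi : ℝ) - lo := by
      have : (lo : ℝ) ≤ hi := by exact_mod_cast hlt.le
      linarith
    -- the credit rate at floor `x` is at most the credit rate at floor `x′`
    have h1x : 0 < 1 - x := by linarith
    have h1x' : 0 < 1 - x' := by linarith
    have key : (if x ≤ g then g else (g - x ^ 2) / (1 - x)) ≤ (if x' ≤ g then g else (g - x' ^ 2) / (1 - x')) := by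
      by_cases hxg : x ≤ g
      · rw [if_pos hxg, if_pos (hxx.trans hxg)]
      · rw [if_neg hxg]
        have hgx : g < x := not_le.1 hxg
        by_cases hxg' : x' ≤ g
        · rw [if_pos hxg', div_le_iff₀ h1x]
          nlinarith [hg.1]
        · rw [if_neg hxg', div_le_div_iff₀ h1x h1x']
          have hgx' : g < x' := not_le.1 hxg'
          have hprod : (0 : ℝ) ≤ x * (1 - x') := mul_nonneg (by linarith [hg.1]) h1x'.le
          have hfac : (0 : ℝ) ≤ x + x' - x * x' - g := by linarith
          nlinarith [mul_nonneg (sub_nonneg.2 hxx) hfac]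
    have := mul_le_mul_of_nonneg_left key hd
    linarith

/-- **DEC(j′) is monotone in the floor**: `x′ ≤ x < 1` and `DECAt x j′ M μ` ⟹ `DECAt x′ j′ M μ` (same decomposition). [this work] -/
theorem decAt_mono_floor {x x' : ℝ} {j' M : ℕ} {μ : ℕ → ℝ} (hxx : x' ≤ x) (hx1 : x < 1) (h : DECAt x j' M μ) :
    DECAt x' j' M μ := by
  obtain ⟨ρ, _, lam, g, lo, hi, h0, h1, hg, hlohi, hhi, hμ, hval⟩ := h
  exact ⟨ρ, inferInstance, lam, g, lo, hi, h0, h1, hg, hlohi, hhi, hμ, fun r hr =>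
    validAt_mono_floor hxx hx1 (hg r) (hval r hr)⟩

end LawDec

/-- **`TreeDEC` at layers `j′ ≥ #A` (Theorem A).**  For gates `q : E → [0,1]`, relays `A`, ancestor sets `P`, `0 < t ≤ 1` with every marginal
`∏_{y ∈ P a} q y ≥ 1 − t`, and `#A ≤ j′`: the law `h ↦ P(#{a ∈ A : P a ⊆ ω} = h)` is DEC(j′) at floor `1 − t`
(`LawDec.decAt_of_top_le`, the affordability of charged atoms being `RootDecGate.floor_mul_atom_le_mean`). [this work] -/
theorem treeDEC_of_card_le {E : Type*} [Fintype E] (q : E → unitInterval) (A : Finset E) (P : E → Finset E) (t : ℝ) (ht : 0 < t)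
    (ht1 : t ≤ 1) (hmarg : ∀ a ∈ A, 1 - ∏ y ∈ P a, (q y : ℝ) ≤ t) (j' : ℕ) (hj : A.card ≤ j') :
    LawDec.DECAt (1 - t) j' A.card
      (fun h => (prodBernoulli q).real {ω : Set E | (A.filter fun a => ((P a : Finset E) : Set E) ⊆ ω).card = h}) := by
  -- one structure: the labelling `comp ≡ ()` of `…QuantFarTreeTAMP`
  have h0 := RootDecGate.real_Nk_eq_zero_of_lt q A P (fun _ : E => ()) ()
  have h1 := RootDecGate.sum_real_Nk_eq_one q A P (fun _ : E => ()) ()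
  have h2 := RootDecGate.floor_mul_atom_le_mean q A P (fun _ : E => ()) () t ht1 hmarg
  simp only [Finset.filter_true] at h0 h1 h2
  exact LawDec.decAt_of_top_le A.card _ (fun h => measureReal_nonneg) h0 h1 (1 - t) (by linarith) h2 j' hj

end Quant

end Summit.CriticalPhenomena.PercolationContinuityZ3.Theorems
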